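import Summits.CriticalPhenomena.PercolationContinuityZ3.Theorems.PercAnnulusCrossingSlabMSFPieces
import HarnessLib

/-!
# RSW3 lane (lead, gen 45): NTW 2017 LEMMA 4.1 — THE GLUING LEMMA FOR INVASION (the sums over the pieces; file F7, second
# part, of the build-out of Theorem 2.4)

builds on p205010 (kernel theorem, internal audit signed; external expert review pending) — NOT used in this file.

Cell `prim-rsw3`, lead seat (gen 45), blueprint `prim-rsw3-lead/gen44/BUILDOUT-PLAN.md` §4.  Support file
(`--supports stmt-CriticalPhenomena-4575`); no definitions, no named facts, no sorries.  Vocabulary of `SlabMSFEvents.lean`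
(`evGlued a = 𝓑_a^{m}`, `evCircuit = C_{n,2n}`, `evBlocked = D′`, `goodLabels = [0,1]^E`, `evStepTwo`, `pieceS`, `pieceLZ`,
`pieceLZW`) at one scale `(n, N, M)` (`N = 2n_i`, `M = m_i - 1`), for two roots `a`, `x` over `B_{n-1}`.

Newman–Tassion–Wu (arXiv:1512.09107, p. 19), **Lemma 4.1 (Gluing lemma for invasion)**: «for any `i > i₀`, and any Borel
measurable set `A ⊂ [0,1]^{B̄_{m_{i-1}}}`, there exist `C₁, C₂, C₃ < ∞` such that
(g1) `P[(𝓑_0)^c, 𝓑_x, 𝒴_A] ≤ C₁ P[𝓑_0, 𝓑_x, 𝒴_A]`, (g2) `P[𝓑_0, (𝓑_x)^c, 𝒴_A] ≤ C₂ P[𝓑_0, 𝓑_x, 𝒴_A]`,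
(g3) `P[(𝓑_0)^c, (𝓑_x)^c, 𝒴_A] ≤ C₃ P[𝓑_0, 𝓑_x, 𝒴_A]`.  As a consequence, there exist `c₁, c₂ > 0` such that
`P[𝓑_0, 𝓑_x, 𝒴_A] ≥ c₂ P[𝒴_A] ≥ c₁ P[A]`.»  Here `𝒴_A = C ∩ D′ ∩ A` and `A` is any measurable set of label fields determined
by the labels of the pairs having an endpoint over `B_{n-1}` (which contains NTW's `σ(B̄_{m_{i-1}})` as soon as
`m_{i-1} ≤ n - 1`); the constants are explicit in `K = (2 / (p ∧ (1-b)))^s`, `s` any bound on the number of modified pairs: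

* **`real_notGlued_glued_le`** — (g1) [and (g2) by exchanging the roots]: `μ([0,1]^E ∩ (𝓑_a)^c ∩ 𝓑_x ∩ 𝒴_A) ≤ 2K μ(𝓑_a ∩ 𝓑_x ∩ 𝒴_A)`
  (Lemma 4.2 = `NTW17.labelMeasure_real_le_of_affineRelabel_self` on the two pieces "Step 2 used / skipped", with the maps of
  `surgery_mapsTo_ZW` / `surgery_mapsTo_Z`);
* **`real_notGlued_le`** — the (g3)-type bound with ONE root: `μ([0,1]^E ∩ (𝓑_a)^c ∩ 𝒴_A) ≤ K μ(𝓑_a ∩ 𝒴_A)` ("one can skip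
  Step 2", `surgery_mapsTo_Z3`);
* **`real_le_glued_glued`** — the consequence: `μ(𝒴_A) ≤ (1 + K)(1 + 2K) μ(𝓑_a ∩ 𝓑_x ∩ 𝒴_A)`, i.e. `c₂ = ((1+K)(1+2K))⁻¹`.
(`[0,1]^E` is almost sure, `real_goodLabels_inter`.)  The second consequence `≥ c₁ P[A]` is the independence of `C ∩ D′` from
`A` (file F8b) and is not proved here.

References: C. M. Newman, V. Tassion, W. Wu, *Critical percolation and the minimal spanning tree in slabs*, CPAM 70 (2017),
arXiv:1512.09107, §4 Lemma 4.1 (p. 19) and its proof §4.1 (pp. 20–21) [NewmanTassionWu2017].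
-/

noncomputable section

namespace Summit.CriticalPhenomena.PercolationContinuityZ3.Theorems.Crossing

open MeasureTheory
open Literature.Probability.Percolation Literature.Probability.LatticeModels
open Literature.Probability.Percolation.NTW17 Literature.Probability.Percolation.Invasion

variable {k : ℕ} {p b : ℝ} {n N M : ℕ} {a x : slab 3 k} {s : ℕ} {A : Set (Sym2 (slab 3 k) → ℝ)}

/-- `[0,1]^E` is almost sure: intersecting with it does not change probabilities. [cite: NewmanTassionWu2017, §2.3 (Ω = [0,1]^E)] -/
theorem real_goodLabels_inter (E : Set (Sym2 (slab 3 k) → ℝ)) :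
    (labelMeasure (slab 3 k)).real (goodLabels k ∩ E) = (labelMeasure (slab 3 k)).real E := by
  have h0 : labelMeasure (slab 3 k) (goodLabels k)ᶜ = 0 := ae_iff.1 (ae_mem_goodLabels (k := k))
  rw [Set.inter_comm]
  exact congrArg ENNReal.toReal (measure_inter_conull h0)

/-- The events of the gluing lemma are measurable. [cite: NewmanTassionWu2017, §4 (Lemma 4.1, "Borel measurable")] -/
theorem measurableSet_glueDomain (hAm : MeasurableSet A) (a x : slab 3 k) :
    MeasurableSet (goodLabels k ∩ (evGlued k p n N M a)ᶜ ∩ evGlued k p n N M x ∩ evCircuit k p n N ∩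
      evBlocked k p N M ∩ A) :=
  ((((measurableSet_goodLabels.inter (measurableSet_evGlued a).compl).inter (measurableSet_evGlued x)).inter
    measurableSet_evCircuit).inter measurableSet_evBlocked).inter hAm

/-- **(g1)/(g2): gluing one invasion while protecting the other.**  For roots `a`, `x` over `B_{n-1}` and a measurable `A`
determined by the labels of the pairs with an endpoint over `B_{n-1}`:
`μ([0,1]^E ∩ (𝓑_a)^c ∩ 𝓑_x ∩ C ∩ D′ ∩ A) ≤ 2 (2/(p ∧ (1-b)))^s μ(𝓑_a ∩ 𝓑_x ∩ C ∩ D′ ∩ A)`.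
[cite: NewmanTassionWu2017, Lemma 4.1 (g1), (g2) and proof §4.1 ("Applying Lemma 4.2 we obtain …")] -/
theorem real_notGlued_glued_le (hp : 0 < p) (hpb : p < b) (hb1 : b < 1) (hn : 1 ≤ n) (hnN : n ≤ N) (hNM : N + 1 ≤ M)
    (ha : planar k a ∈ sqBox ((0 : ℤ), (0 : ℤ)) (n - 1)) (hx : planar k x ∈ sqBox ((0 : ℤ), (0 : ℤ)) (n - 1))
    (hs : ∀ (Γ : List (slab 3 k)) (y : ℤ × ℤ), (surgFin k Γ y).card ≤ s) (hAm : MeasurableSet A)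
    (hA : ∀ U U' : Sym2 (slab 3 k) → ℝ,
      (∀ e, (∃ v ∈ e, planar k v ∈ sqBox ((0 : ℤ), (0 : ℤ)) (n - 1)) → U' e = U e) → U ∈ A → U' ∈ A) :
    (labelMeasure (slab 3 k)).real (goodLabels k ∩ (evGlued k p n N M a)ᶜ ∩ evGlued k p n N M x ∩ evCircuit k p n N ∩
        evBlocked k p N M ∩ A) ≤
      2 * (2 / min p (1 - b)) ^ s *
        (labelMeasure (slab 3 k)).real (evGlued k p n N M a ∩ evGlued k p n N M x ∩ evCircuit k p n N ∩ evBlocked k p N M ∩ A) := by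
  have := isProbabilityMeasure_labelMeasure (slab 3 k)
  set μ := labelMeasure (slab 3 k) with hμ
  set K : ℝ := (2 / min p (1 - b)) ^ s with hK
  set 𝓑 := evGlued k p n N M a ∩ evGlued k p n N M x ∩ evCircuit k p n N ∩ evBlocked k p N M ∩ A with h𝓑
  set 𝓐 := goodLabels k ∩ (evGlued k p n N M a)ᶜ ∩ evGlued k p n N M x ∩ evCircuit k p n N ∩ evBlocked k p N M ∩ A
    with h𝓐
  have h𝓐m : MeasurableSet 𝓐 := measurableSet_glueDomain hAm a x
  have hp1 : p ≤ 1 := hpb.le.trans hb1.le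
  have hb0 : 0 ≤ b := hp.le.trans hpb.le
  -- piece where Step 2 is used
  have h1 : μ.real (𝓐 ∩ evStepTwo k p n N M a x) ≤ K * μ.real 𝓑 := by
    refine labelMeasure_real_le_of_affineRelabel_self hp hp1 hb0 hb1 s
      (pieceS k p n N a) (pieceLZW k p n N M a x) (fun S L => ?_) (fun U _ => ?_) (fun U hU => ?_) (fun U hU => ?_)
      (fun U hU => ?_)
    · exact (h𝓐m.inter (measurableSet_evStepTwo a x)).inter (measurableSet_pieceZW a x S L)
    · rw [pieceS_eq]; exact hs _ _
    · obtain ⟨⟨⟨⟨⟨⟨hg, hna⟩, hgx⟩, hC⟩, hD⟩, -⟩, ht⟩ := hU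
      exact (surgery_mapsTo_ZW hp hpb hb1 hn hnN hNM ha hx hg hna hgx hC hD ht).2.2.2
    · obtain ⟨⟨⟨⟨⟨⟨hg, hna⟩, hgx⟩, hC⟩, hD⟩, hUA⟩, ht⟩ := hU
      obtain ⟨⟨⟨⟨⟨-, hBa⟩, hBx⟩, hC'⟩, hD'⟩, -, -, -⟩ := surgery_mapsTo_ZW hp hpb hb1 hn hnN hNM ha hx hg hna hgx hC hD ht
      exact ⟨⟨⟨⟨hBa, hBx⟩, hC'⟩, hD'⟩,
        hA U _ (fun e he => affineRelabel_pieceS_apply_eq_of_near hn hnN hC ha _ he) hUA⟩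
    · obtain ⟨⟨⟨⟨⟨⟨hg, hna⟩, hgx⟩, hC⟩, hD⟩, -⟩, ht⟩ := hU
      exact (surgery_mapsTo_ZW hp hpb hb1 hn hnN hNM ha hx hg hna hgx hC hD ht).2.2.1
  -- piece where Step 2 is skipped
  have h2 : μ.real (𝓐 \ evStepTwo k p n N M a x) ≤ K * μ.real 𝓑 := by
    refine labelMeasure_real_le_of_affineRelabel_self hp hp1 hb0 hb1 s
      (pieceS k p n N a) (pieceLZ k p n N a) (fun S L => ?_) (fun U _ => ?_) (fun U hU => ?_) (fun U hU => ?_)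
      (fun U hU => ?_)
    · exact (h𝓐m.diff (measurableSet_evStepTwo a x)).inter (measurableSet_pieceZ (p := p) (n := n) (N := N) a x S L)
    · rw [pieceS_eq]; exact hs _ _
    · obtain ⟨⟨⟨⟨⟨⟨hg, hna⟩, hgx⟩, hC⟩, hD⟩, -⟩, ht⟩ := hU
      exact (surgery_mapsTo_Z hp hpb hb1 hn hnN hNM ha hx hg hna hgx hC hD ht).2.2.2
    · obtain ⟨⟨⟨⟨⟨⟨hg, hna⟩, hgx⟩, hC⟩, hD⟩, hUA⟩, ht⟩ := hU
      obtain ⟨⟨⟨⟨⟨-, hBa⟩, hBx⟩, hC'⟩, hD'⟩, -, -, -⟩ := surgery_mapsTo_Z hp hpb hb1 hn hnN hNM ha hx hg hna hgx hC hD ht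
      exact ⟨⟨⟨⟨hBa, hBx⟩, hC'⟩, hD'⟩,
        hA U _ (fun e he => affineRelabel_pieceS_apply_eq_of_near hn hnN hC ha _ he) hUA⟩
    · obtain ⟨⟨⟨⟨⟨⟨hg, hna⟩, hgx⟩, hC⟩, hD⟩, -⟩, ht⟩ := hU
      exact (surgery_mapsTo_Z hp hpb hb1 hn hnN hNM ha hx hg hna hgx hC hD ht).2.2.1
  calc μ.real 𝓐 = μ.real (𝓐 ∩ evStepTwo k p n N M a x) + μ.real (𝓐 \ evStepTwo k p n N M a x) :=
      (measureReal_inter_add_sdiff (s := 𝓐) (measurableSet_evStepTwo a x)).symm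
    _ ≤ K * μ.real 𝓑 + K * μ.real 𝓑 := add_le_add h1 h2
    _ = 2 * K * μ.real 𝓑 := by ring

/-- **(g3)-type bound with one root: "one can skip Step 2".**  For a root `a` over `B_{n-1}` and `A` as above:
`μ([0,1]^E ∩ (𝓑_a)^c ∩ C ∩ D′ ∩ A) ≤ (2/(p ∧ (1-b)))^s μ(𝓑_a ∩ C ∩ D′ ∩ A)`.
[cite: NewmanTassionWu2017, Lemma 4.1 (g3) and proof §4.1 ("a map Φ : (𝓑_0)^c ∩ (𝓑_x)^c ∩ 𝒴_A → (𝓑_0 ∩ 𝓑_x ∩ 𝒴_A) ∪ (𝓑_0 ∩ (𝓑_x)^c ∩ 𝒴_A) … one can skip Step 2")] -/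
theorem real_notGlued_le (hp : 0 < p) (hpb : p < b) (hb1 : b < 1) (hn : 1 ≤ n) (hnN : n ≤ N) (hNM : N + 1 ≤ M)
    (ha : planar k a ∈ sqBox ((0 : ℤ), (0 : ℤ)) (n - 1))
    (hs : ∀ (Γ : List (slab 3 k)) (y : ℤ × ℤ), (surgFin k Γ y).card ≤ s) (hAm : MeasurableSet A)
    (hA : ∀ U U' : Sym2 (slab 3 k) → ℝ,
      (∀ e, (∃ v ∈ e, planar k v ∈ sqBox ((0 : ℤ), (0 : ℤ)) (n - 1)) → U' e = U e) → U ∈ A → U' ∈ A) :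
    (labelMeasure (slab 3 k)).real (goodLabels k ∩ (evGlued k p n N M a)ᶜ ∩ evCircuit k p n N ∩ evBlocked k p N M ∩ A) ≤
      (2 / min p (1 - b)) ^ s *
        (labelMeasure (slab 3 k)).real (evGlued k p n N M a ∩ evCircuit k p n N ∩ evBlocked k p N M ∩ A) := by
  have := isProbabilityMeasure_labelMeasure (slab 3 k)
  have h𝓐m : MeasurableSet (goodLabels k ∩ (evGlued k p n N M a)ᶜ ∩ evCircuit k p n N ∩ evBlocked k p N M ∩ A) :=
    (((measurableSet_goodLabels.inter (measurableSet_evGlued a).compl).inter measurableSet_evCircuit).inter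
      measurableSet_evBlocked).inter hAm
  have hp1 : p ≤ 1 := hpb.le.trans hb1.le
  have hb0 : 0 ≤ b := hp.le.trans hpb.le
  refine labelMeasure_real_le_of_affineRelabel_self hp hp1 hb0 hb1 s
    (pieceS k p n N a) (pieceLZ k p n N a) (fun S L => ?_) (fun U _ => ?_) (fun U hU => ?_) (fun U hU => ?_)
    (fun U hU => ?_)
  · exact h𝓐m.inter (measurableSet_pieceZ (p := p) (n := n) (N := N) a a S L)
  · rw [pieceS_eq]; exact hs _ _
  · obtain ⟨⟨⟨⟨hg, hna⟩, hC⟩, hD⟩, -⟩ := hU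
    exact (surgery_mapsTo_Z3 hp hpb hb1 hn hnN hNM ha hg hna hC hD).2.2.2
  · obtain ⟨⟨⟨⟨hg, hna⟩, hC⟩, hD⟩, hUA⟩ := hU
    obtain ⟨⟨⟨⟨-, hBa⟩, hC'⟩, hD'⟩, -, -, -⟩ := surgery_mapsTo_Z3 hp hpb hb1 hn hnN hNM ha hg hna hC hD
    exact ⟨⟨⟨hBa, hC'⟩, hD'⟩, hA U _ (fun e he => affineRelabel_pieceS_apply_eq_of_near hn hnN hC ha _ he) hUA⟩
  · obtain ⟨⟨⟨⟨hg, hna⟩, hC⟩, hD⟩, -⟩ := hU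
    exact (surgery_mapsTo_Z3 hp hpb hb1 hn hnN hNM ha hg hna hC hD).2.2.1

/-- **NTW Lemma 4.1, the consequence `P[𝓑_0, 𝓑_x, 𝒴_A] ≥ c₂ P[𝒴_A]`**, with `c₂ = ((1+K)(1+2K))⁻¹`, `K = (2/(p ∧ (1-b)))^s`:
for roots `a`, `x` over `B_{n-1}` and a measurable `A` determined by the labels of the pairs with an endpoint over `B_{n-1}`,
`μ(C ∩ D′ ∩ A) ≤ (1+K)(1+2K) · μ(𝓑_a ∩ 𝓑_x ∩ C ∩ D′ ∩ A)`. [cite: NewmanTassionWu2017, Lemma 4.1 ("As a consequence, there exist c₁, c₂ > 0, such that P[𝓑_0^{m_i}, 𝓑_x^{m_i}, 𝒴_A^i] ≥ c₂ P[𝒴_A^i]")] -/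
theorem real_le_glued_glued (hp : 0 < p) (hpb : p < b) (hb1 : b < 1) (hn : 1 ≤ n) (hnN : n ≤ N) (hNM : N + 1 ≤ M)
    (ha : planar k a ∈ sqBox ((0 : ℤ), (0 : ℤ)) (n - 1)) (hx : planar k x ∈ sqBox ((0 : ℤ), (0 : ℤ)) (n - 1))
    (hs : ∀ (Γ : List (slab 3 k)) (y : ℤ × ℤ), (surgFin k Γ y).card ≤ s) (hAm : MeasurableSet A)
    (hA : ∀ U U' : Sym2 (slab 3 k) → ℝ,
      (∀ e, (∃ v ∈ e, planar k v ∈ sqBox ((0 : ℤ), (0 : ℤ)) (n - 1)) → U' e = U e) → U ∈ A → U' ∈ A) :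
    (labelMeasure (slab 3 k)).real (evCircuit k p n N ∩ evBlocked k p N M ∩ A) ≤
      (1 + (2 / min p (1 - b)) ^ s) * (1 + 2 * (2 / min p (1 - b)) ^ s) *
        (labelMeasure (slab 3 k)).real
          (evGlued k p n N M a ∩ evGlued k p n N M x ∩ evCircuit k p n N ∩ evBlocked k p N M ∩ A) := by
  have := isProbabilityMeasure_labelMeasure (slab 3 k)
  set μ := labelMeasure (slab 3 k) with hμ
  set K : ℝ := (2 / min p (1 - b)) ^ s with hK
  set Ga := evGlued k p n N M a with hGa
  set Gx := evGlued k p n N M x with hGx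
  set Y := evCircuit k p n N ∩ evBlocked k p N M ∩ A with hY
  have hK0 : 0 ≤ K := by positivity
  have hYm : MeasurableSet Y := (measurableSet_evCircuit.inter measurableSet_evBlocked).inter hAm
  -- (g3)-type: the part of `Y` off `𝓑_a`
  have hI : μ.real (Y \ Ga) ≤ K * μ.real (Ga ∩ Y) := by
    have h := real_notGlued_le (N := N) (M := M) hp hpb hb1 hn hnN hNM ha hs hAm hA
    have e1 : goodLabels k ∩ (evGlued k p n N M a)ᶜ ∩ evCircuit k p n N ∩ evBlocked k p N M ∩ A =
        goodLabels k ∩ (Y \ Ga) := by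
      ext U; simp only [Set.mem_inter_iff, Set.mem_sdiff, Set.mem_compl_iff, hY, hGa]; tauto
    have e2 : evGlued k p n N M a ∩ evCircuit k p n N ∩ evBlocked k p N M ∩ A = Ga ∩ Y := by
      ext U; simp only [Set.mem_inter_iff, hY, hGa]; tauto
    rw [e1, e2, real_goodLabels_inter] at h
    exact h
  -- (g2)-type: the part of `𝓑_a ∩ Y` off `𝓑_x`, gluing `x` while protecting `a`
  have hII : μ.real ((Ga ∩ Y) \ Gx) ≤ 2 * K * μ.real (Ga ∩ Gx ∩ Y) := by
    have h := real_notGlued_glued_le (M := M) hp hpb hb1 hn hnN hNM hx ha hs hAm hA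
    have e1 : goodLabels k ∩ (evGlued k p n N M x)ᶜ ∩ evGlued k p n N M a ∩ evCircuit k p n N ∩ evBlocked k p N M ∩ A =
        goodLabels k ∩ ((Ga ∩ Y) \ Gx) := by
      ext U; simp only [Set.mem_inter_iff, Set.mem_sdiff, Set.mem_compl_iff, hY, hGa, hGx]; tauto
    have e2 : evGlued k p n N M x ∩ evGlued k p n N M a ∩ evCircuit k p n N ∩ evBlocked k p N M ∩ A = Ga ∩ Gx ∩ Y := by
      ext U; simp only [Set.mem_inter_iff, hY, hGa, hGx]; tauto
    rw [e1, e2, real_goodLabels_inter] at h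
    exact h
  have hsplit1 : μ.real Y = μ.real (Ga ∩ Y) + μ.real (Y \ Ga) := by
    rw [Set.inter_comm]; exact (measureReal_inter_add_sdiff (s := Y) (measurableSet_evGlued a)).symm
  have hsplit2 : μ.real (Ga ∩ Y) = μ.real (Ga ∩ Gx ∩ Y) + μ.real ((Ga ∩ Y) \ Gx) := by
    have := (measureReal_inter_add_sdiff (μ := μ) (s := Ga ∩ Y)
      (measurableSet_evGlued (p := p) (n := n) (N := N) (M := M) x)).symm
    rw [this]
    congr 2
    ext U; simp only [Set.mem_inter_iff, hGx]; tauto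
  have hfinal : evGlued k p n N M a ∩ evGlued k p n N M x ∩ evCircuit k p n N ∩ evBlocked k p N M ∩ A = Ga ∩ Gx ∩ Y := by
    ext U; simp only [Set.mem_inter_iff, hY, hGa, hGx]; tauto
  rw [hfinal]
  have h0 : 0 ≤ μ.real (Ga ∩ Gx ∩ Y) := measureReal_nonneg
  calc μ.real Y = μ.real (Ga ∩ Y) + μ.real (Y \ Ga) := hsplit1
    _ ≤ μ.real (Ga ∩ Y) + K * μ.real (Ga ∩ Y) := by linarith
    _ = (1 + K) * μ.real (Ga ∩ Y) := by ring
    _ ≤ (1 + K) * ((1 + 2 * K) * μ.real (Ga ∩ Gx ∩ Y)) := by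
        refine mul_le_mul_of_nonneg_left ?_ (by linarith)
        rw [hsplit2]
        linarith
    _ = (1 + K) * (1 + 2 * K) * μ.real (Ga ∩ Gx ∩ Y) := by ring

/-- **The renewal input `c · P[A] ≤ P[𝓩 ∩ A]`.**  With `𝓩 = 𝓑_a ∩ 𝓑_x ∩ C` and `A = {U | (U e)_{e ∈ F} ∈ t}` read off a finite
set `F` of pairs over `B̄_{n-1}`: if `c · μ(A) ≤ μ(C ∩ D′ ∩ A)` (independence of `C ∩ D′` from `A` and `P[C ∩ D′] ≥ c`, file F8b),
then `c/((1+K)(1+2K)) · μ(A) ≤ μ(𝓩 ∩ A)` — the hypothesis `hglue` of the renewal lemma `NTW17.ae_frequently_mem_labelMeasure`.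
[cite: NewmanTassionWu2017, Lemma 4.1 ("≥ c₁ P[A]") and §4 ("P[𝓩^i | (𝓩^{i₀})^c, …, (𝓩^{i-1})^c] ≥ c₁")] -/
theorem real_glued_inter_preimage_ge (hp : 0 < p) (hpb : p < b) (hb1 : b < 1) (hn : 1 ≤ n) (hnN : n ≤ N) (hNM : N + 1 ≤ M)
    (ha : planar k a ∈ sqBox ((0 : ℤ), (0 : ℤ)) (n - 1)) (hx : planar k x ∈ sqBox ((0 : ℤ), (0 : ℤ)) (n - 1))
    (hs : ∀ (Γ : List (slab 3 k)) (y : ℤ × ℤ), (surgFin k Γ y).card ≤ s)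
    (F : Finset (Sym2 (slab 3 k))) (hF : ∀ e ∈ F, ∀ v ∈ e, planar k v ∈ sqBox ((0 : ℤ), (0 : ℤ)) (n - 1))
    {t : Set (F → ℝ)} (ht : MeasurableSet t) {c : ℝ}
    (hindep : c * (labelMeasure (slab 3 k)).real ((fun (U : Sym2 (slab 3 k) → ℝ) (e : F) => U e) ⁻¹' t) ≤
      (labelMeasure (slab 3 k)).real (evCircuit k p n N ∩ evBlocked k p N M ∩
        (fun (U : Sym2 (slab 3 k) → ℝ) (e : F) => U e) ⁻¹' t)) :
    c / ((1 + (2 / min p (1 - b)) ^ s) * (1 + 2 * (2 / min p (1 - b)) ^ s)) *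
        (labelMeasure (slab 3 k)).real ((fun (U : Sym2 (slab 3 k) → ℝ) (e : F) => U e) ⁻¹' t) ≤
      (labelMeasure (slab 3 k)).real ((evGlued k p n N M a ∩ evGlued k p n N M x ∩ evCircuit k p n N) ∩
        (fun (U : Sym2 (slab 3 k) → ℝ) (e : F) => U e) ⁻¹' t) := by
  have := isProbabilityMeasure_labelMeasure (slab 3 k)
  set μ := labelMeasure (slab 3 k) with hμ
  set K : ℝ := (2 / min p (1 - b)) ^ s with hK
  set A := (fun (U : Sym2 (slab 3 k) → ℝ) (e : F) => U e) ⁻¹' t with hAdef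
  have hK0 : 0 ≤ K := by positivity
  have hden : 0 < (1 + K) * (1 + 2 * K) := by positivity
  have hAm : MeasurableSet A := ht.preimage (measurable_pi_lambda _ fun e => measurable_pi_apply (e : Sym2 (slab 3 k)))
  have hAdet : ∀ U U' : Sym2 (slab 3 k) → ℝ,
      (∀ e, (∃ v ∈ e, planar k v ∈ sqBox ((0 : ℤ), (0 : ℤ)) (n - 1)) → U' e = U e) → U ∈ A → U' ∈ A := by
    intro U U' hUU' hU
    have heq : (fun e : F => U' e) = fun e : F => U e := by
      funext e
      have hu : (e : Sym2 (slab 3 k)).out.1 ∈ (e : Sym2 (slab 3 k)) := Sym2.out_fst_mem _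
      exact hUU' _ ⟨_, hu, hF e e.2 _ hu⟩
    show (fun e : F => U' e) ∈ t
    rw [heq]; exact hU
  have hmain := real_le_glued_glued (N := N) (M := M) hp hpb hb1 hn hnN hNM ha hx hs hAm hAdet
  have hmono : μ.real (evGlued k p n N M a ∩ evGlued k p n N M x ∩ evCircuit k p n N ∩ evBlocked k p N M ∩ A) ≤
      μ.real ((evGlued k p n N M a ∩ evGlued k p n N M x ∩ evCircuit k p n N) ∩ A) :=
    measureReal_mono fun U hU => ⟨hU.1.1, hU.2⟩
  calc c / ((1 + K) * (1 + 2 * K)) * μ.real A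
      = (c * μ.real A) / ((1 + K) * (1 + 2 * K)) := by ring
    _ ≤ μ.real (evCircuit k p n N ∩ evBlocked k p N M ∩ A) / ((1 + K) * (1 + 2 * K)) :=
        div_le_div_of_nonneg_right hindep hden.le
    _ ≤ μ.real (evGlued k p n N M a ∩ evGlued k p n N M x ∩ evCircuit k p n N ∩ evBlocked k p N M ∩ A) := by
        rw [div_le_iff₀ hden]
        calc μ.real (evCircuit k p n N ∩ evBlocked k p N M ∩ A)
            ≤ (1 + K) * (1 + 2 * K) *
                μ.real (evGlued k p n N M a ∩ evGlued k p n N M x ∩ evCircuit k p n N ∩ evBlocked k p N M ∩ A) := hmain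
          _ = μ.real (evGlued k p n N M a ∩ evGlued k p n N M x ∩ evCircuit k p n N ∩ evBlocked k p N M ∩ A) *
                ((1 + K) * (1 + 2 * K)) := by ring
    _ ≤ μ.real ((evGlued k p n N M a ∩ evGlued k p n N M x ∩ evCircuit k p n N) ∩ A) := hmono

end Summit.CriticalPhenomena.PercolationContinuityZ3.Theorems.Crossing
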